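import Mathlib
import Summits.Ventures.PercRepro2.Defs
import Summits.Ventures.PercRepro2.Graph
import Summits.Ventures.PercRepro2.OneColourSwitch
import Summits.Ventures.PercRepro2.RegionHubSign
import Summits.Ventures.PercRepro2.SideSwitch
import Summits.Ventures.PercRepro2.SideSwitchFibre
import Summits.Ventures.PercRepro2.SideSwitchClosed
import Summits.Ventures.PercRepro2.SideSwitchComps
import Summits.Ventures.PercRepro2.SideSwitchCompsFibre
import Summits.Ventures.PercRepro2.M9NoPocketDefs
import Summits.Ventures.PercRepro2.M9NoPocketWorld
import Summits.Ventures.PercRepro2.M9NoPocketWorldD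
import Summits.Ventures.PercRepro2.M9NoPocketFibre
import Summits.Ventures.PercRepro2.M9PocketUnit
import Summits.Ventures.PercRepro2.M9PocketPsi2

/-!
# The clean partner `Ψ₂` — the status of `d`, the signs, the unit (blind cell PercRepro2,
p3 g39, 2026-08-29; `proofs/P3-POCKETRK.md` §5′ Step 1 and §9 K6, part 2)

Continuation of `M9PocketPsi2` (same setting: a doubly reached point `ω`, a closed set `C` of
`Y`-side blocks containing the `Y`-side neighbours of `d`, `Ψ₂ ω` = the flip of every edge
not touching `C`).  **`d` is `Y`-reached and not `W`-reached at `Ψ₂ ω`** (`d_mem_K2_psi2`,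
`d_notMem_M2_psi2`: `Ψ₂ ω` is a `K`-only point).  **The sign comparison**: a `Y`-path of
`Ψ₂ ω` from `p` avoids `C` (`Sep` at `Ψ₂ ω`) and is made of flipped edges, so it is a `W`-path
of `ω`; a `Y`-path of `ω` from `p` avoids `C` (`Sep` at `ω`) and is a `W`-path of `Ψ₂ ω`
(`conn_compl_of_conn_psi2`, `conn_compl_psi2_of_conn`); hence **`σ_pq(Ψ₂ ω) + σ_pq(ω) ≤ 0`**
(`sigma_pq_psi2_add_nonpos`).  When `C` is the whole `Y`-side (`hfull`) the `Y`-link `r ~_Y s`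
survives (`conn_rs_psi2_of_conn_rs`: the pocket detours of the `Y`-path are shortcut at `d`)
and there is no `W`-link at `Ψ₂ ω` (`eq_of_conn_compl_rs_psi2`), so `σ_rs(Ψ₂ ω) ≥ σ_rs(ω)`
and, for an `EX` point with `σ_rs = 1`, **`σ_pq σ_rs (Ψ₂ ω) + σ_pq σ_rs (ω) ≤ 0`**
(`sigma_mul_psi2_add_nonpos`) — the pointwise pairing of `proofs/P3-POCKETRK.md` §5′ Step 1.
**`Ψ₂ ω` lies in the unit of `ω`** (`nu_endsD_psi2_eq`: the normalisation `nu` of `G − d`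
agrees on every edge touching the worlds of `{r, s}` in `G − d`, which are the same at `ω` and
`Ψ₂ ω`).  Own work; std axioms.
-/

namespace Summit.Ventures.PercRepro2

namespace NoPocket

open Finset Classical OneColourSwitch SideSwitch

variable {V : Type*} {E : Type*} {ends : E → Sym2 V} {p q r s d : V} {ω : Config E}
  {C : Set V}

section Status

variable (hdr : d ≠ r) (hds : d ≠ s)
  (hT : ∀ e, ends e ≠ s(d, r) ∧ ends e ≠ s(d, s))
  (hsep : sep2 ends p q r s ω) (hD : DOne ends r s d ω)
  (hK : d ∈ K2 ends r s ω) (hM : d ∈ M2 ends r s ω)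
  (hC : C ⊆ K2 (endsD ends d) r s ω) (hCr : r ∉ C) (hCs : s ∉ C)
  (hcl : ClosedIn (endsD ends d) (sided (endsD ends d) r s ω) C)
  (hCd : ∀ e y, ends e = s(d, y) → y ∈ K2 (endsD ends d) r s ω → y ∈ C)

include hdr hds in
/-- A vertex in the `Y`-world of `{r, s}` reached through `d` comes with a `Y` edge from `d`
into the `Y`-world of `G − d`. -/
lemma exists_open_edge_d_of_mem_K2 (hK : d ∈ K2 ends r s ω) :
    ∃ e y, ends e = s(d, y) ∧ ω e = true ∧ y ∈ K2 (endsD ends d) r s ω := by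
  have key : ∀ t, (t = r ∨ t = s) → Conn ends ω t d →
      d ∈ {x | x ∈ K2 (endsD ends d) r s ω ∨
        ∃ e y, ends e = s(d, y) ∧ ω e = true ∧ y ∈ K2 (endsD ends d) r s ω} := by
    intro t ht hc
    have htS : t ∈ {x | x ∈ K2 (endsD ends d) r s ω ∨
        ∃ e y, ends e = s(d, y) ∧ ω e = true ∧ y ∈ K2 (endsD ends d) r s ω} := by
      rcases ht with rfl | rfl
      · exact Or.inl (r_mem_K2 t s ω)
      · exact Or.inl (s_mem_K2 r t ω)
    refine mem_of_conn_of_closed ?_ htS hc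
    rintro a (ha | ha) b hab
    · obtain ⟨_, e, he, hends⟩ := openGraph_adj.1 hab
      by_cases hbd : b = d
      · subst hbd
        exact Or.inr ⟨e, a, by rw [hends, Sym2.eq_swap], he, ha⟩
      · have had : a ≠ d := by rintro rfl; exact not_mem_K2_endsD hdr hds ω ha
        have hde : d ∉ ends e := notMem_of_ends_ne hends had hbd
        exact Or.inl (mem_K2_of_open ha he (by rw [endsD_of_notMem hde, hends]))
    · exact Or.inr ha
  have hd : d ∈ {x | x ∈ K2 (endsD ends d) r s ω ∨
      ∃ e y, ends e = s(d, y) ∧ ω e = true ∧ y ∈ K2 (endsD ends d) r s ω} := by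
    rcases mem_K2_iff.1 hK with hc | hc
    · exact key r (Or.inl rfl) hc
    · exact key s (Or.inr rfl) hc
  rcases hd with h | h
  · exact (not_mem_K2_endsD hdr hds ω h).elim
  · exact h

include hdr hds hsep hD hK hC hCr hCs hcl hCd in
/-- **`d` is `Y`-reached at `Ψ₂ ω`**: through its `Y` edge into `C`, which is unchanged. -/
lemma d_mem_K2_psi2 : d ∈ K2 ends r s (fun e => if e ∈ touches ends C then ω e else !ω e) := by
  obtain ⟨e, y, hey, he, hy⟩ := exists_open_edge_d_of_mem_K2 hdr hds hK
  have hyC : y ∈ C := hCd e y hey hy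
  have hyK : y ∈ K2 (endsD ends d) r s (fun e => if e ∈ touches ends C then ω e else !ω e) := by
    rw [K2_endsD_psi2 hdr hds hsep hD hC hCr hCs hcl]
    exact Or.inr hyC
  refine mem_K2_of_open (K2_endsD_subset_K2 _ hyK) ?_ (by rw [hey, Sym2.eq_swap])
  rw [psi2_of_mem (mem_touches_of_ends hey (Or.inr hyC))]
  exact he

include hdr hds hT hD hK hM hC hCr hCs hcl hCd in
/-- **`d` is not `W`-reached at `Ψ₂ ω`.** -/
lemma d_notMem_M2_psi2 :
    d ∉ M2 ends r s (fun e => if e ∈ touches ends C then ω e else !ω e) := by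
  intro h
  exact not_mem_K2_endsD hdr hds ω (M2_psi2_subset hdr hds hT hD hK hM hC hCr hCs hcl hCd h).1

end Status

section Sign

variable (hdr : d ≠ r) (hds : d ≠ s)
  (hT : ∀ e, ends e ≠ s(d, r) ∧ ends e ≠ s(d, s))
  (hsep : sep2 ends p q r s ω) (hD : DOne ends r s d ω)
  (hK : d ∈ K2 ends r s ω) (hM : d ∈ M2 ends r s ω)
  (hC : C ⊆ K2 (endsD ends d) r s ω) (hCr : r ∉ C) (hCs : s ∉ C)
  (hcl : ClosedIn (endsD ends d) (sided (endsD ends d) r s ω) C)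
  (hCd : ∀ e y, ends e = s(d, y) → y ∈ K2 (endsD ends d) r s ω → y ∈ C)

include hdr hds hsep hD hC hCr hCs hcl in
/-- A `Y`-path of `Ψ₂ ω` from `p` never meets `C` (it would reach the `Y`-world) and is made
of flipped edges: it is a `W`-path of `ω`. -/
lemma conn_compl_of_conn_psi2
    (hsep' : sep2 ends p q r s (fun e => if e ∈ touches ends C then ω e else !ω e)) {y : V}
    (h : Conn ends (fun e => if e ∈ touches ends C then ω e else !ω e) p y) :
    Conn ends (OneColourSwitch.compl ω) p y := by
  have hpC : p ∉ C := fun hp => (not_mem_K2_of_sep2 (sep2_endsD_of_sep2 (d := d) hsep)).1 (hC hp)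
  have hpK := (not_mem_K2_of_sep2 hsep').1
  have key : y ∈ {z | z ∉ C ∧ Conn ends (fun e => if e ∈ touches ends C then ω e else !ω e) p z ∧
      Conn ends (OneColourSwitch.compl ω) p z} := by
    refine mem_of_conn_of_closed ?_ ⟨hpC, conn_refl _ _ _, conn_refl _ _ _⟩ h
    rintro a ⟨haC, hac', hac⟩ b hab
    obtain ⟨_, e, he, hends⟩ := openGraph_adj.1 hab
    have hpb : Conn ends (fun e => if e ∈ touches ends C then ω e else !ω e) p b :=
      conn_trans hac' (conn_of_openAdj ⟨e, he, hends⟩)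
    have hbC : b ∉ C := by
      intro hb
      apply hpK
      have hbK : b ∈ K2 (endsD ends d) r s
          (fun e => if e ∈ touches ends C then ω e else !ω e) := by
        rw [K2_endsD_psi2 hdr hds hsep hD hC hCr hCs hcl]; exact Or.inr hb
      rcases mem_K2_iff.1 (K2_endsD_subset_K2 _ hbK) with hc | hc
      · exact mem_K2_iff.2 (Or.inl (conn_trans hc (conn_symm hpb)))
      · exact mem_K2_iff.2 (Or.inr (conn_trans hc (conn_symm hpb)))
    have hnt : e ∉ touches ends C := not_mem_touches_of_ends hends haC hbC
    simp only [psi2_of_notMem hnt] at he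
    have he' : ω e = false := by
      cases h' : ω e
      · rfl
      · rw [h'] at he; exact absurd he (by decide)
    exact ⟨hbC, hpb,
      conn_trans hac (conn_of_openAdj ⟨e, by simp [OneColourSwitch.compl, he'], hends⟩)⟩
  exact key.2.2

include hsep hC in
/-- A `Y`-path of `ω` from `p` never meets `C` (`Sep`) and every edge of it is flipped: it is a
`W`-path of `Ψ₂ ω`. -/
lemma conn_compl_psi2_of_conn {y : V} (h : Conn ends ω p y) :
    Conn ends (OneColourSwitch.compl (fun e => if e ∈ touches ends C then ω e else !ω e)) p y := by
  have hpC : p ∉ C := fun hp => (not_mem_K2_of_sep2 (sep2_endsD_of_sep2 (d := d) hsep)).1 (hC hp)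
  have hpK := (not_mem_K2_of_sep2 hsep).1
  have key : y ∈ {z | z ∉ C ∧ Conn ends ω p z ∧ Conn ends (OneColourSwitch.compl
      (fun e => if e ∈ touches ends C then ω e else !ω e)) p z} := by
    refine mem_of_conn_of_closed ?_ ⟨hpC, conn_refl _ _ _, conn_refl _ _ _⟩ h
    rintro a ⟨haC, hac', hac⟩ b hab
    obtain ⟨_, e, he, hends⟩ := openGraph_adj.1 hab
    have hpb : Conn ends ω p b := conn_trans hac' (conn_of_openAdj ⟨e, he, hends⟩)
    have hbC : b ∉ C := by
      intro hb
      apply hpK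
      rcases mem_K2_iff.1 (K2_endsD_subset_K2 ω (hC hb)) with hc | hc
      · exact mem_K2_iff.2 (Or.inl (conn_trans hc (conn_symm hpb)))
      · exact mem_K2_iff.2 (Or.inr (conn_trans hc (conn_symm hpb)))
    have hnt : e ∉ touches ends C := not_mem_touches_of_ends hends haC hbC
    have he' : OneColourSwitch.compl
        (fun e => if e ∈ touches ends C then ω e else !ω e) e = true := by
      simp [OneColourSwitch.compl, hnt, he]
    exact ⟨hbC, hpb, conn_trans hac (conn_of_openAdj ⟨e, he', hends⟩)⟩
  exact key.2.2

include hdr hds hsep hD hC hCr hCs hcl in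
/-- **The pointwise pairing**: `σ_pq(Ψ₂ ω) + σ_pq(ω) ≤ 0`. -/
lemma sigma_pq_psi2_add_nonpos
    (hsep' : sep2 ends p q r s (fun e => if e ∈ touches ends C then ω e else !ω e)) :
    sigma ends (fun e => if e ∈ touches ends C then ω e else !ω e) p q +
      sigma ends ω p q ≤ 0 := by
  have h1 := conn_compl_of_conn_psi2 hdr hds hsep hD hC hCr hCs hcl hsep' (y := q)
  have h2 := conn_compl_psi2_of_conn hsep hC (y := q)
  simp only [sigma]
  by_cases hY' : Conn ends (fun e => if e ∈ touches ends C then ω e else !ω e) p q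
  · rw [if_pos hY', if_pos (h1 hY')]
    by_cases hY : Conn ends ω p q
    · rw [if_pos hY, if_pos (h2 hY)]; norm_num
    · rw [if_neg hY]; split_ifs <;> norm_num
  · rw [if_neg hY']
    by_cases hY : Conn ends ω p q
    · rw [if_pos hY, if_pos (h2 hY)]; split_ifs <;> norm_num
    · rw [if_neg hY]; split_ifs <;> norm_num

include hdr hds hT hD hK hM hC hCr hCs hcl hCd in
/-- With `C` the whole `Y`-side, there is no `W`-link at `Ψ₂ ω`: the `W`-cluster of `r` is
`{r}` (every `W`-reached vertex lies in `K₂(G − d) ∖ C = {r, s}`, and there is no edge inside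
`{r, s}`). -/
lemma eq_of_conn_compl_rs_psi2 (hrs : within ends ({r, s} : Set V) = ∅)
    (hfull : ∀ x ∈ K2 (endsD ends d) r s ω, x ≠ r → x ≠ s → x ∈ C)
    (h : Conn ends (OneColourSwitch.compl
      (fun e => if e ∈ touches ends C then ω e else !ω e)) r s) : s = r := by
  have hM2 := M2_psi2_subset hdr hds hT hD hK hM hC hCr hCs hcl hCd
  have key : s ∈ {z | z = r} := by
    refine mem_of_conn_of_closed ?_ rfl h
    rintro a ha b hab
    simp only [Set.mem_setOf_eq] at ha ⊢
    subst ha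
    obtain ⟨hne, e, he, hends⟩ := openGraph_adj.1 hab
    exfalso
    -- `b` is `W`-reached from `r` at `Ψ₂ ω`, so `b ∈ K₂(G − d) ∖ C ⊆ {r, s}`
    have hbM : b ∈ M2 ends a s (fun e => if e ∈ touches ends C then ω e else !ω e) :=
      mem_M2_iff.2 (Or.inl (conn_of_openAdj ⟨e, he, hends⟩))
    obtain ⟨hbK, hbC⟩ := hM2 hbM
    have hbs : b = s := by
      by_contra hbs
      exact hbC (hfull b hbK (Ne.symm hne) hbs)
    subst hbs
    have : e ∈ within ends ({a, b} : Set V) := ⟨a, by simp, b, by simp, hends⟩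
    rw [hrs] at this
    exact this
  exact key

include hdr hds hT hD hK hM hC hCr hCs hcl hCd in
/-- With `C` the whole `Y`-side, **the `Y`-link survives**: a `Y`-path from `r` to `s` at `ω`
runs through `Y`-side vertices (all in `C`) and `d`, with pocket detours, and every edge it
uses off the pocket is unchanged; the detours are shortcut at `d`. -/
lemma conn_rs_psi2_of_conn_rs (hrs : within ends ({r, s} : Set V) = ∅)
    (hfull : ∀ x ∈ K2 (endsD ends d) r s ω, x ≠ r → x ≠ s → x ∈ C)
    (h : Conn ends ω r s) :
    Conn ends (fun e => if e ∈ touches ends C then ω e else !ω e) r s := by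
  set ω' := (fun e => if e ∈ touches ends C then ω e else !ω e) with hω'
  -- the invariant along the `Y`-path from `r`
  have key : s ∈ {x | Conn ends ω r x ∧
      ((x ∈ K2 (endsD ends d) r s ω ∨ x = d) → Conn ends ω' r x) ∧
      (x ∉ K2 (endsD ends d) r s ω → x ≠ d →
        x ∉ M2 (endsD ends d) r s ω ∧ Conn ends ω' r d)} := by
    refine mem_of_conn_of_closed ?_ ⟨conn_refl _ _ _, fun _ => conn_refl _ _ _,
      fun hr _ => (hr (r_mem_K2 r s ω)).elim⟩ h
    rintro x ⟨hrx, hx1, hx2⟩ y hxy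
    obtain ⟨_, e, he, hends⟩ := openGraph_adj.1 hxy
    have hry : Conn ends ω r y := conn_trans hrx (conn_of_openAdj ⟨e, he, hends⟩)
    refine ⟨hry, ?_, ?_⟩
    · -- `y` on the `Y`-side or `y = d`: `Y`-reached at `Ψ₂ ω`
      rintro hy
      by_cases hxK : x ∈ K2 (endsD ends d) r s ω
      · have hrx' := hx1 (Or.inl hxK)
        have hxd : x ≠ d := by rintro rfl; exact not_mem_K2_endsD hdr hds ω hxK
        rcases hy with hyK | hyd
        · -- an edge between two `Y`-side vertices (or `r, s`): it touches `C`
          have hyd : y ≠ d := by rintro rfl; exact not_mem_K2_endsD hdr hds ω hyK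
          have htC : e ∈ touches ends C := by
            by_cases hxrs : x = r ∨ x = s
            · by_cases hyrs : y = r ∨ y = s
              · exfalso
                have : e ∈ within ends ({r, s} : Set V) := by
                  refine ⟨x, ?_, y, ?_, hends⟩
                  · rcases hxrs with rfl | rfl <;> simp
                  · rcases hyrs with rfl | rfl <;> simp
                rw [hrs] at this
                exact this
              · exact mem_touches_of_ends hends (Or.inr (hfull y hyK
                  (fun h => hyrs (Or.inl h)) (fun h => hyrs (Or.inr h))))
            · exact mem_touches_of_ends hends (Or.inl (hfull x hxK
                (fun h => hxrs (Or.inl h)) (fun h => hxrs (Or.inr h))))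
          refine conn_trans hrx' (conn_of_openAdj ⟨e, ?_, hends⟩)
          simp only [hω', psi2_of_mem htC]; exact he
        · -- `y = d`: the edge from `x` into `d` is a `Y` edge into `C`, unchanged
          subst y
          have hxC : x ∈ C := hCd e x (by rw [hends, Sym2.eq_swap]) hxK
          refine conn_trans hrx' (conn_of_openAdj ⟨e, ?_, hends⟩)
          simp only [hω', psi2_of_mem (mem_touches_of_ends hends (Or.inl hxC))]; exact he
      · by_cases hxd : x = d
        · -- from `d`: into `C` (unchanged) or a loop
          subst x
          have hrd := hx1 (Or.inr rfl)
          rcases hy with hyK | hyd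
          · have hyC : y ∈ C := hCd e y hends hyK
            refine conn_trans hrd (conn_of_openAdj ⟨e, ?_, hends⟩)
            simp only [hω', psi2_of_mem (mem_touches_of_ends hends (Or.inr hyC))]; exact he
          · subst y; exact hrd
        · -- from a pocket vertex: `y` is `d` (fine) or not sided
          obtain ⟨hxM, hrd⟩ := hx2 hxK hxd
          rcases hy with hyK | hyd
          · exfalso
            have hyd : y ≠ d := by rintro rfl; exact not_mem_K2_endsD hdr hds ω hyK
            have hde : d ∉ ends e := notMem_of_ends_ne hends hxd hyd
            exact hxK (mem_K2_of_open hyK he (by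
              rw [endsD_of_notMem hde, hends, Sym2.eq_swap]))
          · subst y; exact hrd
    · -- `y` a pocket vertex: not `W`-side (it is `Y`-reached from `r`), and `d` was reached
      intro hyK hyd
      have hyM : y ∉ M2 (endsD ends d) r s ω := by
        intro hyM
        have hyr : y ≠ r := by rintro rfl; exact hyK (r_mem_K2 y s ω)
        have hys : y ≠ s := by rintro rfl; exact hyK (s_mem_K2 r y ω)
        exact hD y hyr hys hyd (mem_K2_iff.2 (Or.inl hry)) (M2_endsD_subset_M2 ω hyM)
      refine ⟨hyM, ?_⟩
      by_cases hxK : x ∈ K2 (endsD ends d) r s ω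
      · -- an open edge from the `Y`-side to a pocket vertex: impossible (not at `d`)
        exfalso
        have hxd : x ≠ d := by rintro rfl; exact not_mem_K2_endsD hdr hds ω hxK
        have hde : d ∉ ends e := notMem_of_ends_ne hends hxd hyd
        exact hyK (mem_K2_of_open hxK he (by rw [endsD_of_notMem hde, hends]))
      · by_cases hxd : x = d
        · subst x; exact hx1 (Or.inr rfl)
        · exact (hx2 hxK hxd).2
  exact key.2.1 (Or.inl (s_mem_K2 r s ω))

include hdr hds hT hD hK hM hC hCr hCs hcl hCd in
/-- With `C` the whole `Y`-side: **`σ_rs(Ψ₂ ω) ≥ σ_rs(ω)` and `σ_rs(Ψ₂ ω) ≥ 0`.** -/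
lemma sigma_rs_psi2 (hrs : within ends ({r, s} : Set V) = ∅)
    (hfull : ∀ x ∈ K2 (endsD ends d) r s ω, x ≠ r → x ≠ s → x ∈ C) :
    sigma ends ω r s ≤ sigma ends (fun e => if e ∈ touches ends C then ω e else !ω e) r s ∧
      0 ≤ sigma ends (fun e => if e ∈ touches ends C then ω e else !ω e) r s := by
  have hW := eq_of_conn_compl_rs_psi2 hdr hds hT hD hK hM hC hCr hCs hcl hCd hrs hfull
  have hY := conn_rs_psi2_of_conn_rs hdr hds hT hD hK hM hC hCr hCs hcl hCd hrs hfull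
  simp only [sigma]
  by_cases hsr : s = r
  · subst hsr
    rw [if_pos (conn_refl _ _ _), if_pos (conn_refl _ _ _), if_pos (conn_refl _ _ _)]
    split_ifs <;> norm_num
  · rw [if_neg (fun h => hsr (hW h))]
    by_cases h : Conn ends ω r s
    · rw [if_pos h, if_pos (hY h)]; split_ifs <;> norm_num
    · rw [if_neg h]; split_ifs <;> norm_num

include hdr hds hT hsep hD hK hM hC hCr hCs hcl hCd in
/-- **The pointwise pairing of an `EX` point with `σ_rs = 1` and its clean partner**
(`C` the whole `Y`-side): `σ_pq σ_rs (Ψ₂ ω) + σ_pq σ_rs (ω) ≤ 0`. -/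
lemma sigma_mul_psi2_add_nonpos (hrs : within ends ({r, s} : Set V) = ∅)
    (hfull : ∀ x ∈ K2 (endsD ends d) r s ω, x ≠ r → x ≠ s → x ∈ C) (hp : p ≠ d) (hq : q ≠ d)
    (hY : Conn ends ω r s) (hW : ¬ Conn ends (OneColourSwitch.compl ω) r s) :
    sigma ends (fun e => if e ∈ touches ends C then ω e else !ω e) p q *
        sigma ends (fun e => if e ∈ touches ends C then ω e else !ω e) r s +
      sigma ends ω p q * sigma ends ω r s ≤ 0 := by
  have hsr : s ≠ r := fun h => hW (h ▸ conn_refl _ _ _)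
  have hsep' := sep2_psi2 hdr hds hT hsep hD hK hM hC hCr hCs hcl hCd hp hq
  have hpq := sigma_pq_psi2_add_nonpos hdr hds hsep hD hC hCr hCs hcl hsep'
  have hrs1 : sigma ends ω r s = 1 := by
    simp only [sigma, if_pos hY, if_neg hW]; norm_num
  have hrs1' : sigma ends (fun e => if e ∈ touches ends C then ω e else !ω e) r s = 1 := by
    have hY' := conn_rs_psi2_of_conn_rs hdr hds hT hD hK hM hC hCr hCs hcl hCd hrs hfull hY
    have hW' : ¬ Conn ends (OneColourSwitch.compl
        (fun e => if e ∈ touches ends C then ω e else !ω e)) r s :=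
      fun h => hsr (eq_of_conn_compl_rs_psi2 hdr hds hT hD hK hM hC hCr hCs hcl hCd hrs hfull h)
    simp only [sigma, if_pos hY', if_neg hW']; norm_num
  rw [hrs1, hrs1', mul_one, mul_one]
  exact hpq

end Sign

end NoPocket

end Summit.Ventures.PercRepro2
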